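import Summits.AtomisticToContinuum.Crystallization.Theorems.ReggeStarCoercivityDefectFreeCrystallizesPalmDefs
import Summits.AtomisticToContinuum.Crystallization.Theorems.PalmUnimodularRigidityChargedPatternCrystallizes
import Summits.AtomisticToContinuum.Crystallization.Theorems.PalmUnimodularRigidityCruxesToPalmRigidity

/-!
# Part 2 of the proof of `stub_goodLaw : GoodLawOfZeroDefects` (P1 of line `palm-good-law`, crux stmt-AtomisticToContinuum-13603): nullity of bad events, the `η → 0` compactness step

See the module docstring of the final part `ReggeStarCoercivityDefectFreeCrystallizesGoodLaw.lean` for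
the overview. Contents:

* `measure_setOf_eq_zero_of_good` — under the density-transfer clause of the Benjamini–Schramm limit
  (item 9230) and `defects / N → 0`, every event `Bad` that no `Good` particle can be `(R, ε)`-matched
  into is `P`-null (outer measure; no measurability needed);
* `exists_bijOn_of_frequently` — compactness of `[9/10, 11/10] × O(3) × {bijections}`: matchings at
  tolerances `1/20 + η n`, `η n → 0`, of a FIXED finite set give a matching at tolerance `1/20`;
* `exists_bijOn_limit` — for a separated set, the punctured open balls of radii `6/5 - η n` stabilise,
  so root-goodness at all levels `η n` gives an exact `1/20`-matching of the punctured open ball of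
  radius `6/5`.
-/

noncomputable section

open Filter Topology MeasureTheory

namespace Summit.AtomisticToContinuum.Crystallization.Theorems.PalmGoodLaw

open Summit.AtomisticToContinuum.Crystallization.Theorems.DefectFreeCrystallizes.Negative.PredicateAPI
open Literature.MathematicalPhysics.StatisticalMechanics Literature.Geometry.DiscreteGeometry
open Literature.Probability.Process

/-! ### Nullity of events no good particle is matched into -/

/-- **Bad events are null.** Let `P` be a finite law of configurations, a.s. rooted `δ`-hard-core,
satisfying the density-transfer clause of item 9230 along `φ` for the configurations `x`, and let
`defects (x N) / N → 0`. If `Bad` is an event such that no `Good` particle of any `x N` can have its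
recentred configuration `(R, ε)`-matched both ways to a rooted `δ`-hard-core `ν ∈ Bad`, then
`P Bad = 0`: otherwise density transfer yields eventually `≥ ρ φ(j)` matched — hence defective —
particles with `ρ = P(Bad ∩ hard-core)/2 > 0`. -/
theorem measure_setOf_eq_zero_of_good {x : (N : ℕ) → (Fin N → EuclideanSpace ℝ (Fin 3))}
    {φ : ℕ → ℕ} (hφ : StrictMono φ)
    {P : Measure (Measure (EuclideanSpace ℝ (Fin 3)))} [IsFiniteMeasure P] {δ : ℝ}
    (hcore : ∀ᵐ μ ∂P, IsRootedHardCore δ μ)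
    (htr : ∀ T : Set (Measure (EuclideanSpace ℝ (Fin 3))), ∀ R ε : ℝ, 0 < ε → ∀ ρ : ℝ,
      ρ < (P T).toReal → ∀ᶠ j : ℕ in atTop,
        ρ * (φ j : ℝ) ≤ (Nat.card {i : Fin (φ j) // ∃ ν ∈ T,
          ((∀ p : EuclideanSpace ℝ (Fin 3), ν {p} ≠ 0 → ‖p‖ ≤ R →
              ∃ q ∈ (Set.range (fun k : Fin (φ j) => x (φ j) k - x (φ j) i)), dist q p ≤ ε) ∧
           (∀ q ∈ (Set.range (fun k : Fin (φ j) => x (φ j) k - x (φ j) i)), ‖q‖ ≤ R →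
              ∃ p : EuclideanSpace ℝ (Fin 3), ν {p} ≠ 0 ∧ dist q p ≤ ε))} : ℝ))
    (hZ : Tendsto (fun N : ℕ => (defects (x N) : ℝ) / N) atTop (𝓝 0))
    {Bad : Measure (EuclideanSpace ℝ (Fin 3)) → Prop} {R ε : ℝ} (hε : 0 < ε)
    (hgeo : ∀ (N : ℕ) (i : Fin N) (ν : Measure (EuclideanSpace ℝ (Fin 3))), IsRootedHardCore δ ν →
      Bad ν → Good (x N) i →
      (∀ p : EuclideanSpace ℝ (Fin 3), ν {p} ≠ 0 → ‖p‖ ≤ R →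
          ∃ q ∈ (Set.range (fun k : Fin N => x N k - x N i)), dist q p ≤ ε) →
      (∀ q ∈ (Set.range (fun k : Fin N => x N k - x N i)), ‖q‖ ≤ R →
          ∃ p : EuclideanSpace ℝ (Fin 3), ν {p} ≠ 0 ∧ dist q p ≤ ε) → False) :
    P {ν | Bad ν} = 0 := by
  set T : Set (Measure (EuclideanSpace ℝ (Fin 3))) := {ν | Bad ν ∧ IsRootedHardCore δ ν} with hT
  have hT0 : P T = 0 := by
    by_contra hne
    have hpos : 0 < (P T).toReal := ENNReal.toReal_pos hne (measure_ne_top P T)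
    have hev := htr T R ε hε ((P T).toReal / 2) (half_lt_self hpos)
    -- the counted particles are defective
    have hev' : ∀ᶠ j : ℕ in atTop, (P T).toReal / 2 * (φ j : ℝ) ≤ (defects (x (φ j)) : ℝ) := by
      filter_upwards [hev] with j hj
      refine hj.trans (Nat.cast_le.2 ?_)
      unfold defects
      refine Nat.card_le_card_of_injective (Subtype.map id fun i hi hg => ?_)
        (Subtype.map_injective _ Function.injective_id)
      obtain ⟨ν, ⟨hbad, hhc⟩, h1, h2⟩ := hi
      exact hgeo (φ j) i ν hhc hbad hg h1 h2
    -- but the defect fraction tends to `0` along `φ`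
    have hlim : Tendsto (fun j : ℕ => (defects (x (φ j)) : ℝ) / (φ j : ℝ)) atTop (𝓝 0) :=
      hZ.comp hφ.tendsto_atTop
    have hsmall : ∀ᶠ j : ℕ in atTop, (defects (x (φ j)) : ℝ) / (φ j : ℝ) < (P T).toReal / 2 :=
      hlim.eventually (gt_mem_nhds (half_pos hpos))
    have hj1 : ∀ᶠ j : ℕ in atTop, 1 ≤ φ j := hφ.tendsto_atTop.eventually (eventually_ge_atTop 1)
    obtain ⟨j, h1, h2, h3⟩ := (hev'.and (hsmall.and hj1)).exists
    have hφpos : (0 : ℝ) < φ j := by exact_mod_cast h3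
    rw [div_lt_iff₀ hφpos] at h2
    linarith
  have hsub : {ν | Bad ν} ⊆ T ∪ {ν | ¬ IsRootedHardCore δ ν} := by
    intro ν hν
    by_cases h : IsRootedHardCore δ ν
    · exact Or.inl ⟨hν, h⟩
    · exact Or.inr h
  exact measure_mono_null hsub (measure_union_null hT0 (ae_iff.1 hcore))

/-! ### The compactness step `η → 0` for a fixed finite set -/

/-- **Approximate matchings of a fixed finite set pass to the limit.** If, frequently in `n`, the
finite set `F` is in bijection with the pattern `Pat` with `dist (a_n⁻¹ • f_n v) (A_n v) ≤ 1/20 + η n`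
for some scale `a_n ∈ [9/10, 11/10]` and some linear isometry `A_n`, and `η n → 0`, then some
bijection, scale and isometry achieve tolerance exactly `1/20`: one of the finitely many maps
`Pat → F` occurs infinitely often, and along a further subsequence the isometries (compact `O(3)`,
`exists_subseq_tendsto_linearIsometry`) and the scales (compact interval) converge. -/
theorem exists_bijOn_of_frequently {F Pat : Finset (EuclideanSpace ℝ (Fin 3))} {η : ℕ → ℝ}
    (hη : Tendsto η atTop (𝓝 0))
    (h : ∃ᶠ n in atTop, ∃ a : ℝ, 9 / 10 ≤ a ∧ a ≤ 11 / 10 ∧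
      ∃ A : EuclideanSpace ℝ (Fin 3) →ₗᵢ[ℝ] EuclideanSpace ℝ (Fin 3),
      ∃ f : EuclideanSpace ℝ (Fin 3) → EuclideanSpace ℝ (Fin 3),
        Set.BijOn f (↑Pat : Set (EuclideanSpace ℝ (Fin 3))) ↑F ∧
        ∀ v ∈ Pat, dist (a⁻¹ • f v) (A v) ≤ 1 / 20 + η n) :
    ∃ a : ℝ, 9 / 10 ≤ a ∧ a ≤ 11 / 10 ∧
      ∃ A : EuclideanSpace ℝ (Fin 3) →ₗᵢ[ℝ] EuclideanSpace ℝ (Fin 3),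
      ∃ f : EuclideanSpace ℝ (Fin 3) → EuclideanSpace ℝ (Fin 3),
        Set.BijOn f (↑Pat : Set (EuclideanSpace ℝ (Fin 3))) ↑F ∧
        ∀ v ∈ Pat, dist (a⁻¹ • f v) (A v) ≤ 1 / 20 := by
  classical
  obtain ⟨ψ₀, hψ₀, hall⟩ := extraction_of_frequently_atTop h
  choose a ha₁ ha₂ A f hbij hdist using hall
  -- restrict the matchings to maps `Pat → F` (a finite type) and pigeonhole
  let g : ℕ → (↥Pat → ↥F) := fun k v => ⟨f k v, (hbij k).mapsTo v.2⟩
  obtain ⟨g₀, -, hfreq⟩ :=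
    exists_frequently_eq_of_forall_mem (F := Finset.univ) (y := g) fun k => Finset.mem_univ _
  obtain ⟨ψ₁, hψ₁, hg₀⟩ := extraction_of_frequently_atTop hfreq
  -- compactness of the isometries, then of the scales
  obtain ⟨ψ₂, hψ₂, B, hB⟩ := exists_subseq_tendsto_linearIsometry fun k => A (ψ₁ k)
  obtain ⟨a₀, ha₀, ψ₃, hψ₃, hlim⟩ :=
    (isCompact_Icc : IsCompact (Set.Icc (9 / 10 : ℝ) (11 / 10))).tendsto_subseq
      (x := fun k => a (ψ₁ (ψ₂ k))) fun k => ⟨ha₁ _, ha₂ _⟩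
  refine ⟨a₀, ha₀.1, ha₀.2, B, f (ψ₁ 0), hbij _, fun v hv => ?_⟩
  -- along `Ψ := ψ₁ ∘ ψ₂ ∘ ψ₃` all matchings agree with `f (ψ₁ 0)` on `Pat`
  have hagree : ∀ k, f (ψ₁ (ψ₂ (ψ₃ k))) v = f (ψ₁ 0) v := by
    intro k
    have h1 := congrFun (hg₀ (ψ₂ (ψ₃ k))) ⟨v, hv⟩
    have h2 := congrFun (hg₀ 0) ⟨v, hv⟩
    have h3 := congrArg Subtype.val (h1.trans h2.symm)
    exact h3
  have hbd : ∀ k, dist ((a (ψ₁ (ψ₂ (ψ₃ k))))⁻¹ • f (ψ₁ 0) v) (A (ψ₁ (ψ₂ (ψ₃ k))) v) ≤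
      1 / 20 + η (ψ₀ (ψ₁ (ψ₂ (ψ₃ k)))) := by
    intro k
    rw [← hagree k]
    exact hdist _ v hv
  -- pass to the limit
  have hA : Tendsto (fun k => A (ψ₁ (ψ₂ (ψ₃ k))) v) atTop (𝓝 (B v)) := by
    have h1 : Tendsto (fun k => (A (ψ₁ (ψ₂ (ψ₃ k)))).toContinuousLinearMap) atTop
        (𝓝 B.toContinuousLinearMap) := hB.comp hψ₃.tendsto_atTop
    exact ((ContinuousLinearMap.apply ℝ (EuclideanSpace ℝ (Fin 3)) v).continuous.tendsto _).comp h1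
  have ha0 : (0 : ℝ) < a₀ := by linarith [ha₀.1]
  have hsm : Tendsto (fun k => (a (ψ₁ (ψ₂ (ψ₃ k))))⁻¹ • f (ψ₁ 0) v) atTop
      (𝓝 (a₀⁻¹ • f (ψ₁ 0) v)) :=
    (hlim.inv₀ ha0.ne').smul tendsto_const_nhds
  have hL := hsm.dist hA
  have hR : Tendsto (fun k => 1 / 20 + η (ψ₀ (ψ₁ (ψ₂ (ψ₃ k))))) atTop (𝓝 (1 / 20 + 0)) :=
    tendsto_const_nhds.add (hη.comp ((hψ₀.comp (hψ₁.comp (hψ₂.comp hψ₃))).tendsto_atTop))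
  rw [add_zero] at hR
  exact le_of_tendsto_of_tendsto' hL hR hbd

/-! ### Stabilisation of the punctured open balls and the limit matching -/

/-- **From root-goodness at all levels to an exact matching of the punctured open ball.** Let `S`
be `δ`-separated (`δ > 0`), `η n ≥ 0`, `η n → 0`, and suppose that frequently in `n` the points of
`S ∖ {0}` of norm `< 6/5 - η n` are matched to `Pat` at tolerance `1/20 + η n` (after a scale in
`[9/10, 11/10]` and a linear isometry). Then the points of `S ∖ {0}` of norm `< 6/5` are matched to
`Pat` at tolerance `1/20`: the punctured open balls stabilise (finitely many points, all of norm
`< 6/5`), and `exists_bijOn_of_frequently` applies. -/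
theorem exists_bijOn_limit {S : Set (EuclideanSpace ℝ (Fin 3))} {δ : ℝ} (hδ : 0 < δ)
    (hsep : ∀ p ∈ S, ∀ q ∈ S, p ≠ q → δ ≤ dist p q) {η : ℕ → ℝ} (hη0 : ∀ n, 0 ≤ η n)
    (hη : Tendsto η atTop (𝓝 0)) {Pat : Finset (EuclideanSpace ℝ (Fin 3))}
    (h : ∃ᶠ n in atTop, ∃ a : ℝ, 9 / 10 ≤ a ∧ a ≤ 11 / 10 ∧
      ∃ A : EuclideanSpace ℝ (Fin 3) →ₗᵢ[ℝ] EuclideanSpace ℝ (Fin 3),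
      ∃ f : EuclideanSpace ℝ (Fin 3) → EuclideanSpace ℝ (Fin 3),
        Set.BijOn f (↑Pat : Set (EuclideanSpace ℝ (Fin 3)))
          {p : EuclideanSpace ℝ (Fin 3) | p ∈ S ∧ p ≠ 0 ∧ ‖p‖ < 6 / 5 - η n} ∧
        ∀ v ∈ Pat, dist (a⁻¹ • f v) (A v) ≤ 1 / 20 + η n) :
    ∃ a : ℝ, 9 / 10 ≤ a ∧ a ≤ 11 / 10 ∧
      ∃ A : EuclideanSpace ℝ (Fin 3) →ₗᵢ[ℝ] EuclideanSpace ℝ (Fin 3),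
      ∃ f : EuclideanSpace ℝ (Fin 3) → EuclideanSpace ℝ (Fin 3),
        Set.BijOn f (↑Pat : Set (EuclideanSpace ℝ (Fin 3)))
          {p : EuclideanSpace ℝ (Fin 3) | p ∈ S ∧ p ≠ 0 ∧ ‖p‖ < 6 / 5} ∧
        ∀ v ∈ Pat, dist (a⁻¹ • f v) (A v) ≤ 1 / 20 := by
  -- the punctured open ball of radius `6/5` is finite
  have hF : {p : EuclideanSpace ℝ (Fin 3) | p ∈ S ∧ p ≠ 0 ∧ ‖p‖ < 6 / 5}.Finite := by
    refine (LocalConfig.finite_inter_of_separated hδ hsep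
      (isCompact_closedBall (0 : EuclideanSpace ℝ (Fin 3)) (6 / 5))).subset ?_
    rintro p ⟨hpS, -, hpn⟩
    exact ⟨mem_closedBall_zero_iff.2 hpn.le, hpS⟩
  -- and eventually equal to the punctured open balls of radii `6/5 - η n`
  have hev : ∀ᶠ n in atTop, {p : EuclideanSpace ℝ (Fin 3) | p ∈ S ∧ p ≠ 0 ∧ ‖p‖ < 6 / 5 - η n} =
      ↑hF.toFinset := by
    have h1 : ∀ᶠ n in atTop, ∀ p ∈ {p : EuclideanSpace ℝ (Fin 3) | p ∈ S ∧ p ≠ 0 ∧ ‖p‖ < 6 / 5},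
        ‖p‖ < 6 / 5 - η n := by
      refine hF.eventually_all.2 fun p hp => ?_
      have hgap : 0 < 6 / 5 - ‖p‖ := by linarith [hp.2.2]
      filter_upwards [hη.eventually (gt_mem_nhds hgap)] with n hn
      linarith
    filter_upwards [h1] with n hn
    rw [hF.coe_toFinset]
    ext p
    exact ⟨fun hp => ⟨hp.1, hp.2.1, by linarith [hp.2.2, hη0 n]⟩, fun hp => ⟨hp.1, hp.2.1, hn p hp⟩⟩
  -- so the hypothesis is a statement about the fixed finite set `hF.toFinset`
  have h' : ∃ᶠ n in atTop, ∃ a : ℝ, 9 / 10 ≤ a ∧ a ≤ 11 / 10 ∧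
      ∃ A : EuclideanSpace ℝ (Fin 3) →ₗᵢ[ℝ] EuclideanSpace ℝ (Fin 3),
      ∃ f : EuclideanSpace ℝ (Fin 3) → EuclideanSpace ℝ (Fin 3),
        Set.BijOn f (↑Pat : Set (EuclideanSpace ℝ (Fin 3))) ↑hF.toFinset ∧
        ∀ v ∈ Pat, dist (a⁻¹ • f v) (A v) ≤ 1 / 20 + η n := by
    refine (h.and_eventually hev).mono fun n hn => ?_
    obtain ⟨⟨a, ha₁, ha₂, A, f, hf, hd⟩, hn⟩ := hn
    exact ⟨a, ha₁, ha₂, A, f, hn ▸ hf, hd⟩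
  obtain ⟨a, ha₁, ha₂, A, f, hf, hd⟩ := exists_bijOn_of_frequently hη h'
  exact ⟨a, ha₁, ha₂, A, f, by rwa [hF.coe_toFinset] at hf, hd⟩

/-- Landing anchor of this file (registered stub of crux stmt-AtomisticToContinuum-13603; re-exports `exists_bijOn_limit` for the fcc pattern). -/
theorem goodLaw_part02_anchor : ∀ (S : Set (EuclideanSpace ℝ (Fin 3))) (δ : ℝ), 0 < δ → (∀ p ∈ S, ∀ q ∈ S, p ≠ q → δ ≤ dist p q) → ∀ η : ℕ → ℝ, (∀ n, 0 ≤ η n) → Filter.Tendsto η Filter.atTop (nhds 0) → (∃ᶠ n in Filter.atTop, ∃ a : ℝ, 9 / 10 ≤ a ∧ a ≤ 11 / 10 ∧ ∃ A : EuclideanSpace ℝ (Fin 3) →ₗᵢ[ℝ] EuclideanSpace ℝ (Fin 3), ∃ f : EuclideanSpace ℝ (Fin 3) → EuclideanSpace ℝ (Fin 3), Set.BijOn f (Literature.Geometry.DiscreteGeometry.fccKissingPattern : Set (EuclideanSpace ℝ (Fin 3))) {p : EuclideanSpace ℝ (Fin 3) | p ∈ S ∧ p ≠ 0 ∧ ‖p‖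 < 6 / 5 - η n} ∧ ∀ v ∈ Literature.Geometry.DiscreteGeometry.fccKissingPattern, dist (a⁻¹ • f v) (A v) ≤ 1 / 20 + η n) → ∃ a : ℝ, 9 / 10 ≤ a ∧ a ≤ 11 / 10 ∧ ∃ A : EuclideanSpace ℝ (Fin 3) →ₗᵢ[ℝ] EuclideanSpace ℝ (Fin 3), ∃ f : EuclideanSpace ℝ (Fin 3) → EuclideanSpace ℝ (Fin 3), Set.BijOn f (Literature.Geometry.DiscreteGeometry.fccKissingPattern : Set (EuclideanSpace ℝ (Fin 3))) {p : EuclideanSpace ℝ (Fin 3) | p ∈ S ∧ p ≠ 0 ∧ ‖p‖ < 6 / 5} ∧ ∀ v ∈ Literature.Geometry.DiscreteGeometry.fccKissingPattern, dist (a⁻¹ • f v) (A v) ≤ 1 / 20 :=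
  fun _ _ hδ hsep _ hη0 hη h => exists_bijOn_limit hδ hsep hη0 hη h

end Summit.AtomisticToContinuum.Crystallization.Theorems.PalmGoodLaw

end
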